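/- LEAD seat `ym-line-cbag-p1` (prover-ym-line-cbag-p1-g24-0), route `EguchiKawaiDirectionLadder` (ideator ym-idea-2, LINE 8),
crux K_A `TripleSmallBallMargin` (stmt-QuantumFields-27724), architecture note ARCH-27724-lead-g24 §1/§5: the route-posited OBJECTS of
the lead's stub list v7 — the per-pair rigidity factor `pairFactor`, the ENTRYWISE RIGIDITY statement (S1/S2; w3's engine in circle
form, a HYPOTHESIS here) and the PAIR SMALL-BALL statement (S4) — definitions only, so that the proofs `PairSmallBall ⇐ EntrywiseRigidity`
(file `…PairSmallBall.lean`) and (a′) `⇐ EntrywiseRigidity` (file `…FreeTripleOfRigidity.lean`) land against importable objects.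
ROUTE-INDEPENDENT (no Theses import).  Nothing here bears on the Yang–Mills mass gap (barrier-ledger line onto `EguchiKawaiBreakdown`). -/
import Literature.Barriers.QuantumFields.EguchiKawaiBreakdownLowerBound
import HarnessLib

/-!
# Route `EguchiKawaiDirectionLadder`, crux `TripleSmallBallMargin`: rigidity objects (per-pair factor, entrywise rigidity, pair small ball)

* `pairFactor s x = min(1, s/x)` (value `1` for `x ≤ s`, in particular at `x = 0`): the per-pair rigidity factor; the cancellation
  `x · pairFactor s x ≤ s` (`mul_pairFactor_le`) against the Vandermonde factor `x = |d_j − d_k|²` of Weyl's formula is what turns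
  entrywise rigidity into `N`-uniform small-ball exponents.
* `EntrywiseRigidity` — for every `η > 0` there are `κ ≥ 1`, `C ≥ 0`, `N₀` such that for `N ≥ N₀`, `0 < t ≤ 1` and every DIAGONAL unitary
  `D = diag(d)`: `Haar{W : S_R(D, W) ≤ t} ≤ exp(N²(C − η log t)) · ∏_{j<k} pairFactor (κt) |d_j − d_k|²`
  (`S_R(D,W) = ‖DW − WD‖_F²/(2N) = Σ_{jk} |d_j − d_k|² |W_jk|²/(2N)`, `(![D, W] : EKConfig 2 N) = ![D, W]`).  The circle form of w3's
  nested-pattern engine (`HaarColumns.haar_measure_entrywise_le`); typed here as a statement, proved elsewhere.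
* `PairSmallBall` — the `d = 2` unconditional Eguchi–Kawai small-ball bound `ekHaar 2 N {S_R ≤ t} ≤ exp(N²(C − η log t)) · t^{C(N,2)}`.

Definitions (and the elementary `pairFactor` inequalities) only; no claim about either statement is made in this file.
-/

set_option autoImplicit false

noncomputable section

open MeasureTheory
open scoped ENNReal
open Literature.Barriers.QuantumFields

namespace Summit.QuantumFields.YangMills.Theorems.EguchiKawaiDirectionLadder

open Literature.MathematicalPhysics.QuantumFieldTheory (haarProbability)

variable {N : ℕ}

/-! ### The per-pair rigidity factor -/

/-- The per-pair rigidity factor `min(1, s/x)`, with the convention `1` whenever `x ≤ s` (so also at `x = 0`). -/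
def pairFactor (s x : ℝ) : ℝ := if x ≤ s then 1 else s / x

/-- `0 ≤ pairFactor s x` for `s ≥ 0`. -/
theorem pairFactor_nonneg {s : ℝ} (hs : 0 ≤ s) (x : ℝ) : 0 ≤ pairFactor s x := by
  unfold pairFactor
  split_ifs with h
  · exact zero_le_one
  · exact div_nonneg hs (le_trans hs (le_of_lt (not_le.1 h)))

/-- `pairFactor s x ≤ 1` for `s ≥ 0`. -/
theorem pairFactor_le_one {s : ℝ} (hs : 0 ≤ s) (x : ℝ) : pairFactor s x ≤ 1 := by
  unfold pairFactor
  split_ifs with h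
  · exact le_rfl
  · have hx : s < x := not_le.1 h
    exact (div_le_one (lt_of_le_of_lt hs hx)).2 hx.le

/-- **The cancellation against the Vandermonde factor**: `x · pairFactor s x ≤ s` for `s ≥ 0`. -/
theorem mul_pairFactor_le {s : ℝ} (hs : 0 ≤ s) (x : ℝ) : x * pairFactor s x ≤ s := by
  unfold pairFactor
  split_ifs with h
  · rw [mul_one]; exact h
  · have hx' : s < x := not_le.1 h
    rw [mul_div_cancel₀ s (ne_of_gt (lt_of_le_of_lt hs hx'))]

/-- `pairFactor` is monotone in the budget: `s ≤ s' ⇒ pairFactor s x ≤ pairFactor s' x` (for `0 ≤ s`). -/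
theorem pairFactor_mono {s s' x : ℝ} (hs : 0 ≤ s) (hss' : s ≤ s') : pairFactor s x ≤ pairFactor s' x := by
  unfold pairFactor
  split_ifs with h h'
  · exact le_rfl
  · exact absurd (h.trans hss') h'
  · exact (div_le_one (lt_of_le_of_lt hs (not_le.1 h))).2 (not_le.1 h).le
  · exact div_le_div_of_nonneg_right hss' (le_trans hs (not_le.1 h).le)

/-! ### The two route-posited statements -/

/-- **ENTRYWISE RIGIDITY** (hypothesis; the circle form of w3's nested-pattern engine, stub S1/S2 of the architecture note of
stmt-QuantumFields-27724): a Haar unitary `W` facing a FIXED diagonal unitary `D = diag(d)` at reduced-action precision `t` pays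
`min(1, κt/|d_j − d_k|²)` per unordered eigenvalue pair, up to `exp(N²(C − η log t))`, uniformly in `N ≥ N₀` and `0 < t ≤ 1`. -/
def EntrywiseRigidity : Prop :=
  ∀ η : ℝ, 0 < η → ∃ κ : ℝ, 1 ≤ κ ∧ ∃ C : ℝ, 0 ≤ C ∧ ∃ N₀ : ℕ, ∀ N : ℕ, N₀ ≤ N → ∀ t : ℝ, 0 < t → t ≤ 1 →
    ∀ (D : UN N) (d : Fin N → ℂ), (D : Matrix (Fin N) (Fin N) ℂ) = Matrix.diagonal d →
      haarProbability (UN N) {W : UN N | ekAction ((![D, W] : EKConfig 2 N)) ≤ t} ≤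
        ENNReal.ofReal (Real.exp ((N : ℝ) ^ 2 * (C - η * Real.log t)) *
          ∏ j : Fin N, ∏ k ∈ Finset.Ioi j, pairFactor (κ * t) (‖d j - d k‖ ^ 2))

/-- **PAIR SMALL BALL** (the `d = 2` unconditional Eguchi–Kawai small-ball bound, exponent `C(N,2) = N(N−1)/2`, i.e. one factor `t`
per unordered pair): `ekHaar 2 N {S_R ≤ t} ≤ exp(N²(C − η log t)) · t^{C(N,2)}` for `N ≥ N₀`, `0 < t ≤ 1`. -/
def PairSmallBall : Prop :=
  ∀ η : ℝ, 0 < η → ∃ C : ℝ, 0 ≤ C ∧ ∃ N₀ : ℕ, ∀ N : ℕ, N₀ ≤ N → ∀ t : ℝ, 0 < t → t ≤ 1 →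
    ekHaar 2 N {U : EKConfig 2 N | ekAction U ≤ t} ≤
      ENNReal.ofReal (Real.exp ((N : ℝ) ^ 2 * (C - η * Real.log t)) * t ^ N.choose 2)

end Summit.QuantumFields.YangMills.Theorems.EguchiKawaiDirectionLadder

end
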